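import Summits.HodgeConjecture.HodgeConjecture.Cruxes.BlochSeedDiscOne.SigmaH

/-!
# ROW-α3 — an honest ((D4)-free) lower bound for `h¹(N_Z)` and the honest budget clause (hsemireg-semihom-1 g66)

Evidence-grade companion of `ROW-ALPHA3-NZ-LOWERBOUND-semihom1-g66.md` (director R19.832 (D3) ∕ HANDOFF § g65 (2)).  Typed over
`DepthBoundA4.Design` and the letter calculus of `SigmaH`; `import SigmaH` only; 0 `sorry`, no `axiom` ∕ `instance` ∕ `notation` ∕ `unsafe` ∕
`native_decide`.  NOTHING here is proved toward HC ∕ HC_CM ∕ HC_AV ∕ №4 ∕ 26512 ∕ 18881 ∕ 30548 ∕ H2; `RuleD`, `HallUp`, `BudgetClause`, `SPlus`,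
`sigmaH` and the stub `stub_rung_pad4_seedAt` are untouched.  The geometry (THEOREM A′, LEMMA M, LEMMA CAP below) is PEN, stated in the module
docstring and in the docstrings of the `def`s it prices; the kernel content is: the floor functionals, `floor ≤ ceiling` (`phiSep_le_sigmaH`),
the direction of the doors (`budgetClause_of_le`, `sPlus_mono`), the honest rank cap (`rank_le_116_of_honest`), and the B136 digits.

## The (D4) problem in one line
`SigmaH.sigmaH D = 28·copies + extPN D 1 + extNP D 3 + extNN D 2 + extPP D 2` is the TOTAL DIMENSION OF THE E₁ PAGE in total degree 2 of the
three-column spectral sequence `E₁^{p,q} = H^q(X, End^p K) ⇒ Ext^{p+q}(𝓔,𝓔)` of the display `K = [𝓟 → 𝓝] ≃ 𝓔` (columns `p = −1, 0, 1`: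
`Hom(𝓝,𝓟)`, `End 𝓟 ⊕ End 𝓝`, `Hom(𝓟,𝓝)`), evaluated in the SEPARATED currency (every copy its own generic Pic⁰ atom: degenerate factor
classes carry no cohomology, the diagonal is `28` per copy).  Hence `ext²(𝓔,𝓔) ≤ sigmaH D` in that currency — a CEILING.  The clause of record
`RuleDPlate.BudgetClause σ π D : σ D + 28·(r − 4) + π ≤ 3 136` is a NECESSARY condition for Bloch-semiregularity of the seed `Z` only when `σ D` is a
LOWER bound for `ext²(𝓔,𝓔)`; with `σ = sigmaH` that needs E₁ = E_∞ ((D4)).  ROW-α3 replaces `sigmaH` by functionals `Φ` with `Φ D ≤ ext²(𝓔_φ,𝓔_φ)`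
for every `φ` (and, for `phiAll`, every Pic⁰ decoration), keeping the clause's shape: the honest clause is literally `BudgetClause Φ π`.

## THEOREM A′ (PEN; = c4-1 g2 PROP FS made effective: no Serre twist in the four-ample room)
`X = S⁴`, `S = E_i × E_i`, letters `(a; x, y) ↦ a·h + β̄·e + β·ē` (`DepthBoundA4`), `χ = n = a² − x² − y²`.  Let `D` be a two-term design read as a
READING-1 quotient presentation `0 → 𝓟 → 𝓝 → 𝓔 → 0` (`𝓟 = ⊕ P-cells`, `𝓝 = ⊕ N-cells`, any Pic⁰ decoration, `φ` injective, `𝓔` locally free of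
rank `r = D.rank ≥ 4`), `m := r − 3`, `V = ⊕_η P_η^{n_η}` a Pic⁰-split numerically trivial frame of rank `m` (`Σ n_η = m`; trivial frame: one `η`,
`n_η = m`; generic split frame: all `n_η = 1`), `ψ ∈ Hom(V, 𝓔)` general, `Z := D_{m−1}(ψ)` (codimension 4, `[Z] = c₄(𝓔)`), `Z̃ ⊂ P(V)` its
kernel-line resolution.  HYPOTHESES, all decidable on the letters of `D`:
 (4A) FOUR-AMPLE ROOM: every letter of every cell is ample on its factor (`a > 0`, `a² > x² + y²`) — automatic on the height-`h` alphabet for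
      co-level `c ≤ (h−1)/2` (at `h = 14`: `c ≤ 6`), and for EVERY design after the up-shift `shiftD t`, `t ≥ t₀(D)`;
 (TW_j), `j ∈ {m+1, m+2}`: every class `ν₀ − (ν₁ + … + ν_j)` (`ν₀` a cell letter, `ν₁..ν_j` cell letters of the same factor, repetitions as in
      `Λ^{j−k}𝓝^∨ ⊗ S^k𝓟^∨`) is anti-ample on its factor; SUFFICIENT: `j·a_min − a_max > (j+1)·|β|_max` per factor (true after a finite up-shift);
 (GEN) `𝓔 ⊗ η` globally generated for the `η` of the frame (sufficient: every N-letter globally generated on `S`), `D_{m−2}(ψ) = ∅` (expected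
      codimension 10 > 8) and `Z` smooth of codimension 4 for general `ψ` (Kleiman–Bertini for degeneracy loci; Fulton IT Thm 14.4).
CLAIM: (i) `H^a(X, 𝓔 ⊗ η) = 0` (`a ≥ 1`), `H^a(X, 𝓔^∨ ⊗ η) = 0` and `H^a(X, Λ^j𝓔^∨ ⊗ η) = 0` (`a ≤ 7`, `j ≥ 1`), `H^a(X, 𝓔 ⊗ Λ^j𝓔^∨ ⊗ η) = 0`
(`a ≤ 6`, `j ∈ {m+1, m+2}`), for every `η ∈ Pic⁰(X)` — i.e. the four vanishing hypotheses of c4-1 g2 §1 hold at `t = 0`;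
(ii) hence (c4-1 PROP FS (FS0)–(FS2) verbatim): `h¹(Z̃, N_{Z̃∕P(V)}) = ext²(𝓔,𝓔)`, the maps `H^a(T_{P(V)∕X}|_{Z̃}) → H^a(N_{Z̃∕P(V)})` vanish for
`a = 1, 2`, and **`h¹(N_{Z∕X}) = ext²(𝓔,𝓔) + 28·(Σ_η n_η² − 1)`** EXACTLY — trivial frame `+ 28((r−3)² − 1)` (`SigmaH.FrameBudget`'s constant),
generic split frame `+ 28(r − 4)` (`RuleDPlate.BudgetClause`'s constant), every split frame `≥ + 28(r − 4)`.
PROOF SKETCH of (i): a four-ample cell `⊗ η` has cohomology only in degree 0 and a four-anti-ample one only in degree 8 (Mumford's index theorem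
per factor + Künneth; Pic⁰-twists do not change the cohomology of a non-degenerate class); `𝓔` is a quotient of `𝓝` by `𝓟` ⇒ `H^{≥1}(𝓔⊗η) = 0`;
`Λ^j𝓔^∨` has the exact Koszul-type resolution `0 → Λ^j𝓔^∨ → Λ^j𝓝^∨ → Λ^{j−1}𝓝^∨ ⊗ 𝓟^∨ → … → S^j𝓟^∨ → 0` by sums of four-anti-ample cells, and a
kernel of a complex of sheaves with `H^{≤7} = 0` has `H^{≤7} = 0` (`H^b(K_i) ≅ H^{b−1}(K_{i+1})`); tensoring with `0 → 𝓟 → 𝓝 → 𝓔 → 0` and (TW_j)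
gives the last vanishing in degrees `≤ 6`.  (ii) is then c4-1's Koszul–Lefschetz computation on `Z̃ = V(s) ⊂ P(V)`, `s ∈ H⁰(π^*𝓔 ⊗ 𝒪(1))`:
the terms `Λ^j(π^*𝓔^∨(−1)) ⊗ M` with `2 ≤ j ≤ m` have no cohomology along `P^{m−1}`, `j = 1` and `j ≥ m+1` are killed by (i), so
`H^a(𝒪_{Z̃}) = H^a(𝒪_X)`, `H^a(π^*V(1)|_{Z̃}) = H^a(End V)` (`a ≤ 3`), `H¹(N_{Z̃∕P}) = E_∞^{−1,2} = H²(End 𝓔)`; the relative Euler sequence gives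
`H^a(T_{P(V)∕X}|_{Z̃}) = H^a(𝒪_X) ⊗ (H⁰(End V)∕ℂ)`, and these classes lift to `H^a(P(V), π^*V(1))` whence they map to `H^a(N_{Z̃∕P})` through
`H^a(P(V), π^*𝓔(1)) = H^a(X, 𝓔 ⊗ V^∨) = 0` (`a ≥ 1`): the frame sequence `0 → H¹(N_{Z̃∕P}) → H¹(N_{Z∕X}) → H²(T_{P(V)∕X}|_{Z̃}) → 0` is exact.

## LEMMA CAP (PEN; per-factor cohomology of a degenerate difference class under a Pic⁰ decoration `δ`)
On `S`: a non-degenerate class has `(h⁰,h¹,h²) = (n,0,0) ∕ (0,|n|,0) ∕ (0,0,n)` for every `δ` (index theorem).  The zero class: `(1,2,1)` if `δ = 0`,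
else `(0,0,0)`.  A null class `L ≠ 0` (`n = 0`): `L ≡ k·F`, `F = K(L)⁰` an elliptic curve, `k ≥ 1` the multiple of the primitive ray vector
(saturation of the letter lattice in `NS(S)` assumed), `π_F : S → B := S∕F`; then `L ⊗ δ ≅ π_F^*M` (`deg M = ±k`) iff `δ ∈ π_F^* Pic⁰(B)`, with
`(h⁰,h¹,h²) = (k,k,0)` (`Δa > 0`) ∕ `(0,k,k)` (`Δa < 0`) by Leray (`R¹π_{F*}𝒪_S = 𝒪_B`), and `(0,0,0)` otherwise (`δ|_F ≠ 0` kills `Rπ_{F*}`).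
So `capList` below is a componentwise UPPER bound for every decoration, and the value `0` (`SigmaH.pairDim`) a LOWER bound.

## LEMMA M (PEN, five lines; the three-piece Morse floor — uses only the SHAPE of the spectral sequence, no block-support facts)
Columns `p ∈ {−1,0,1}` ⇒ `d_r = 0` for `r ≥ 3`, `d₂ : E₂^{−1,q} → E₂^{1,q−1}` only.  Hence `E_∞^{0,2} = E₂^{0,2}`, `E_∞^{1,1} = E₃^{1,1}`,
`E_∞^{−1,3} = E₃^{−1,3}`, and with `e^{p,q} := dim E₁^{p,q} = h^q(End^p)`:
  `ext²(𝓔,𝓔) = Σ_p dim E_∞^{p,2−p} ≥ (e^{0,2} − e^{1,2} − e^{−1,2})⁺ + (e^{1,1} − e^{0,1} − e^{−1,2})⁺ + (e^{−1,3} − e^{0,3} − e^{1,2})⁺`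
(each piece: dimension of a kernel ≥ source − target, of a cokernel ≥ target − source).  For a floor valid for EVERY decoration take the positive
terms at their decoration-free minima (separated values: `SigmaH`'s functionals, diagonal `28·copies`) and the subtracted terms at their maxima
(LEMMA CAP): this is `phiAll`.  In the separated currency itself both are the `SigmaH` functionals: `phiSep`.  c4-1 g5's ROW Σ-K ∕ Σ-DIAG ∕ Σ-H
are the sharper floors of the same page (per Künneth multidegree; with the block support of `d₁`); they are per-design machine rows in the LABELLED
currency and are not re-typed here.

## THEOREM C (ROW-α3, PEN from A′ + M): under (4A), (TW), (GEN), if `Z` is Bloch-semiregular then `h¹(N_{Z∕X}) ≤ h^{3,5}(X) = 3 136`, so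
`Φ(D) + 28(r − 4) ≤ Φ(D) + 28(Σ n_η² − 1) ≤ 3 136` for every honest floor `Φ` — i.e. `BudgetClause Φ 0 D` (any split frame) and `FrameBudget Φ D`
(trivial frame) HOLD.  Consequences: the door `SPlus h Φ π` is STRONGER than `SPlus h sigmaH π` (`sPlus_mono` + `phiSep_le_sigmaH`); the honest
clause still caps the rank, `r ≤ 116` (`rank_le_116_of_honest`), but yields NO uniform cap on `copies` (Φ can vanish: LINE-14 designs of record have
`phiAll = 0`), so `SigmaH.copies_add_rank_le_of_budget` (`copies + r ≤ 116`) is exactly as strong as (D4) at the diagonal.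

## Numerics (hub-local, `code/g66/alpha3_floor.py`, stdlib, exact; ×2 against the tree: `sigmaH B136 = 16 096`, `extPN B136 1 = 12 288`; against
c4-1 g5 `diag-table`: live arrows ∕ mass ∕ DIAG of a1a8405d, a009d00f (128 ∕ 1 648 ∕ 832), hub3 (872), hub4 (688), p40 (0) all reproduced)
B136: `phiSep = 11 200` (kernel: `phiSep_B136`; the (1,1) piece `12 288 − 8·136`), `+112 = 11 312 > 3 136` — B136 is killed HONESTLY in the separated
currency (`not_budgetClause_phiSep_B136`); undecorated (labelled) currency floor `120 320`; decoration-free certificate `phiAll = 0` (no kill certified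
across exotic decorations).  LINE-14 designs of record (a1a8405d, a009d00f, hub3∕4, p40-u8; D33-S′; B6c ×3): `phiAll = 0` throughout; labelled-currency
Morse floor kills a009d00f (`7 744 + 1 008`) and D33-S′ (`437 468`), not the others (c4-1's Σ-H does: a1a8405d `19 584`).
-/

set_option linter.dupNamespace false
set_option autoImplicit false

namespace Summit.HodgeConjecture.HodgeConjecture.Cruxes.BlochSeedDiscOne.RowAlpha3

open Summit.HodgeConjecture.HodgeConjecture.Cruxes.BlochSeedDiscOne.DepthBoundA4
open Summit.HodgeConjecture.HodgeConjecture.Cruxes.BlochSeedDiscOne.HeightTower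
open Summit.HodgeConjecture.HodgeConjecture.Cruxes.BlochSeedDiscOne.LeggedFloor
open Summit.HodgeConjecture.HodgeConjecture.Cruxes.BlochSeedDiscOne.HallB136
open Summit.HodgeConjecture.HodgeConjecture.Cruxes.BlochSeedDiscOne.RuleDPlate
open Summit.HodgeConjecture.HodgeConjecture.Cruxes.BlochSeedDiscOne.SigmaH

/-! ## §1 LEMMA CAP as a functional: per-factor caps and the capped cross terms -/

/-- Upper bounds `[h⁰, h¹, h²]` for the difference class `ν − p` on one factor over ALL Pic⁰ decorations (LEMMA CAP): non-degenerate = exact value in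
its Mumford index; zero class `[1,2,1]`; null class of multiple `k = gcd(Δa, Δx, Δy)`: `[k,k,0]` (`Δa > 0`) ∕ `[0,k,k]` (`Δa < 0`). -/
def capList (p ν : Letter) : List ℕ :=
  if 0 < dn p ν then (if p.a < ν.a then [hdim p ν, 0, 0] else [0, 0, hdim p ν])
  else if dn p ν < 0 then [0, hdim p ν, 0]
  else if ν = p then [1, 2, 1]
  else
    let k := Nat.gcd (Nat.gcd (ν.a - p.a).natAbs (ν.x - p.x).natAbs) (ν.y - p.y).natAbs
    if p.a < ν.a then [k, k, 0] else [0, k, k]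

/-- coefficientwise sum of two coefficient lists. -/
def padd : List ℕ → List ℕ → List ℕ
  | [], t => t
  | s, [] => s
  | a :: s, b :: t => (a + b) :: padd s t

/-- product of two coefficient lists (Künneth convolution). -/
def pmul : List ℕ → List ℕ → List ℕ
  | [], _ => []
  | a :: s, t => padd (t.map fun b => a * b) (0 :: pmul s t)

/-- `[h⁰_cap, …, h⁸_cap]` of `Hom(p, ν) = ⊠_f 𝒪(ν_f − p_f)` (caps multiplied over the four factors). -/
def cellCapPoly (p ν : Cell) : List ℕ :=
  pmul (capList (p 0) (ν 0)) (pmul (capList (p 1) (ν 1)) (pmul (capList (p 2) (ν 2)) (capList (p 3) (ν 3))))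

/-- `h^d_cap(Hom(p, ν))`. -/
def cellCap (d : ℕ) (p ν : Cell) : ℕ := (cellCapPoly p ν).getD d 0

/-- `Σ_{P×N} m_p m_ν h^d_cap(Hom(p,ν))` ≥ `dim E₁^{1,d} = h^d(Hom(𝓟,𝓝))` for every decoration. -/
def extPNcap (E : Design) (d : ℕ) : ℕ := dsum (cellCap d) E.P E.N

/-- `≥ h^d(Hom(𝓝,𝓟))` for every decoration. -/
def extNPcap (E : Design) (d : ℕ) : ℕ := dsum (cellCap d) E.N E.P

/-- `≥ h^d(End 𝓝)` for every decoration — ordered entry pairs INCLUDING the self-pairs (zero class, cap `h^d(𝒪_X)·m²`). -/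
def extNNcap (E : Design) (d : ℕ) : ℕ := dsum (cellCap d) E.N E.N

/-- `≥ h^d(End 𝓟)` for every decoration (self-pairs included). -/
def extPPcap (E : Design) (d : ℕ) : ℕ := dsum (cellCap d) E.P E.P

/-! ## §2 LEMMA M as functionals: the three-piece Morse floors -/

/-- `z⁺ = max z 0`, spelled out. -/
def pos (z : ℤ) : ℤ := max z 0

/-- **Φ_sep** — the Morse floor in the SEPARATED currency (the currency of `sigmaH`: degenerate factor classes dead, diagonal `28·copies`):
`(e^{0,2} − e^{1,2} − e^{−1,2})⁺ + (e^{1,1} − e^{0,1} − e^{−1,2})⁺ + (e^{−1,3} − e^{0,3} − e^{1,2})⁺` with `e^{0,q} = C(8,q)·copies + extNN D q + extPP D q`,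
`e^{1,q} = extPN D q`, `e^{−1,q} = extNP D q`.  LEMMA M: `Φ_sep(D) ≤ ext²(𝓔_φ,𝓔_φ)` for every `φ` of a separated-decorated presentation. -/
def phiSep (D : Design) : ℤ :=
  pos (28 * (D.copies : ℤ) + (extNN D 2 : ℤ) + (extPP D 2 : ℤ) - (extPN D 2 : ℤ) - (extNP D 2 : ℤ))
  + pos ((extPN D 1 : ℤ) - (8 * (D.copies : ℤ) + (extNN D 1 : ℤ) + (extPP D 1 : ℤ)) - (extNP D 2 : ℤ))
  + pos ((extNP D 3 : ℤ) - (56 * (D.copies : ℤ) + (extNN D 3 : ℤ) + (extPP D 3 : ℤ)) - (extPN D 2 : ℤ))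

/-- **Φ_all** — the decoration-free Morse floor: positive terms at their separated minima, subtracted terms at their caps (LEMMA CAP; the capped
same-side sums contain the diagonal `C(8,q)·Σ m²`).  LEMMA M + LEMMA CAP: `Φ_all(D) ≤ ext²(𝓔_φ,𝓔_φ)` for EVERY Pic⁰ decoration and every `φ`. -/
def phiAll (D : Design) : ℤ :=
  pos (28 * (D.copies : ℤ) + (extNN D 2 : ℤ) + (extPP D 2 : ℤ) - (extPNcap D 2 : ℤ) - (extNPcap D 2 : ℤ))
  + pos ((extPN D 1 : ℤ) - ((extNNcap D 1 : ℤ) + (extPPcap D 1 : ℤ)) - (extNPcap D 2 : ℤ))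
  + pos ((extNP D 3 : ℤ) - ((extNNcap D 3 : ℤ) + (extPPcap D 3 : ℤ)) - (extPNcap D 2 : ℤ))

/-- The honest clause has the SHAPE of the clause of record — it IS `BudgetClause Φ π D` with an honest floor `Φ` in place of `sigmaH`
(no new `Prop` is introduced; `honest_clause_unfold` records the reading). -/
theorem honest_clause_unfold (Φ : Design → ℤ) (π : ℤ) (D : Design) :
    BudgetClause Φ π D ↔ Φ D + 28 * (D.rank - 4) + π ≤ 3136 := Iff.rfl

/-! ## §3 Kernel facts: floor ≤ ceiling, direction of the doors, the honest rank cap -/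

theorem pos_sub_le (a t : ℤ) (ha : 0 ≤ a) (ht : 0 ≤ t) : pos (a - t) ≤ a := by
  unfold pos
  exact max_le (by omega) ha

theorem pos_nonneg (z : ℤ) : 0 ≤ pos z := by
  unfold pos
  exact le_max_right _ _

/-- **floor ≤ ceiling**: `Φ_sep(D) ≤ Σ-H(D)` for every design (each Morse piece is at most its E₁ term; the three E₁ terms sum to `sigmaH`). -/
theorem phiSep_le_sigmaH (D : Design) : phiSep D ≤ sigmaH D := by
  unfold phiSep sigmaH
  have h1 : pos (28 * (D.copies : ℤ) + (extNN D 2 : ℤ) + (extPP D 2 : ℤ) - (extPN D 2 : ℤ) - (extNP D 2 : ℤ))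
      ≤ 28 * (D.copies : ℤ) + (extNN D 2 : ℤ) + (extPP D 2 : ℤ) := by
    have := pos_sub_le (28 * (D.copies : ℤ) + (extNN D 2 : ℤ) + (extPP D 2 : ℤ)) ((extPN D 2 : ℤ) + (extNP D 2 : ℤ))
      (by positivity) (by positivity)
    simpa [sub_sub] using this
  have h2 : pos ((extPN D 1 : ℤ) - (8 * (D.copies : ℤ) + (extNN D 1 : ℤ) + (extPP D 1 : ℤ)) - (extNP D 2 : ℤ)) ≤ (extPN D 1 : ℤ) := by
    have := pos_sub_le (extPN D 1 : ℤ) ((8 * (D.copies : ℤ) + (extNN D 1 : ℤ) + (extPP D 1 : ℤ)) + (extNP D 2 : ℤ))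
      (by positivity) (by positivity)
    simpa [sub_sub] using this
  have h3 : pos ((extNP D 3 : ℤ) - (56 * (D.copies : ℤ) + (extNN D 3 : ℤ) + (extPP D 3 : ℤ)) - (extPN D 2 : ℤ)) ≤ (extNP D 3 : ℤ) := by
    have := pos_sub_le (extNP D 3 : ℤ) ((56 * (D.copies : ℤ) + (extNN D 3 : ℤ) + (extPP D 3 : ℤ)) + (extPN D 2 : ℤ))
      (by positivity) (by positivity)
    simpa [sub_sub] using this
  omega

theorem phiSep_nonneg (D : Design) : 0 ≤ phiSep D := by
  unfold phiSep
  have h1 := pos_nonneg (28 * (D.copies : ℤ) + (extNN D 2 : ℤ) + (extPP D 2 : ℤ) - (extPN D 2 : ℤ) - (extNP D 2 : ℤ))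
  have h2 := pos_nonneg ((extPN D 1 : ℤ) - (8 * (D.copies : ℤ) + (extNN D 1 : ℤ) + (extPP D 1 : ℤ)) - (extNP D 2 : ℤ))
  have h3 := pos_nonneg ((extNP D 3 : ℤ) - (56 * (D.copies : ℤ) + (extNN D 3 : ℤ) + (extPP D 3 : ℤ)) - (extPN D 2 : ℤ))
  omega

theorem phiAll_nonneg (D : Design) : 0 ≤ phiAll D := by
  unfold phiAll
  have h1 := pos_nonneg (28 * (D.copies : ℤ) + (extNN D 2 : ℤ) + (extPP D 2 : ℤ) - (extPNcap D 2 : ℤ) - (extNPcap D 2 : ℤ))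
  have h2 := pos_nonneg ((extPN D 1 : ℤ) - ((extNNcap D 1 : ℤ) + (extPPcap D 1 : ℤ)) - (extNPcap D 2 : ℤ))
  have h3 := pos_nonneg ((extNP D 3 : ℤ) - ((extNNcap D 3 : ℤ) + (extPPcap D 3 : ℤ)) - (extPNcap D 2 : ℤ))
  omega

/-- a smaller functional makes the clause EASIER to satisfy … -/
theorem budgetClause_of_le {Φ σ : Design → ℤ} (hle : ∀ D, Φ D ≤ σ D) (π : ℤ) (D : Design) (h : BudgetClause σ π D) :
    BudgetClause Φ π D := by
  unfold BudgetClause at *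
  have := hle D
  omega

/-- … hence the door with the smaller functional is the STRONGER statement: `SPlus h Φ π → SPlus h σ π`. -/
theorem sPlus_mono {Φ σ : Design → ℤ} (hle : ∀ D, Φ D ≤ σ D) (h : ℤ) (π : ℤ) (H : SPlus h Φ π) : SPlus h σ π := by
  intro D hA hD hA1 hR hH hP hμ hB
  exact H D hA hD hA1 hR hH hP hμ (budgetClause_of_le hle π D hB)

/-- in particular the honest door implies the Σ-H door of record (never conversely). -/
theorem sPlus_sigmaH_of_phiSep (h : ℤ) (π : ℤ) (H : SPlus h phiSep π) : SPlus h sigmaH π :=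
  sPlus_mono phiSep_le_sigmaH h π H

theorem frameBudget_of_le {Φ σ : Design → ℤ} (hle : ∀ D, Φ D ≤ σ D) (D : Design) (h : FrameBudget σ D) : FrameBudget Φ D := by
  unfold FrameBudget at *
  have := hle D
  omega

/-- **what survives honestly of the mass caps**: the frame piece alone (THEOREM A′ (ii)) caps the rank — any honest floor is `≥ 0`, so the honest
clause with `π ≥ 0` gives `r ≤ 116`; no cap on `copies` follows (Φ may vanish). -/
theorem rank_le_116_of_honest (Φ : Design → ℤ) (hΦ : ∀ D, 0 ≤ Φ D) (π : ℤ) (hπ : 0 ≤ π) (D : Design) (h : BudgetClause Φ π D) :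
    D.rank ≤ 116 := by
  unfold BudgetClause at h
  have := hΦ D
  omega

theorem rank_le_116_of_phiAll (π : ℤ) (hπ : 0 ≤ π) (D : Design) (h : BudgetClause phiAll π D) : D.rank ≤ 116 :=
  rank_le_116_of_honest phiAll phiAll_nonneg π hπ D h

/-! ## §4 B136 digits (kernel `decide`, as in `SigmaH` §3) and the honest verdicts on B136 -/

theorem extPN_B136_two : extPN B136 2 = 55296 := by decide +kernel

theorem extNP_B136_two : extNP B136 2 = 0 := by decide +kernel

theorem extNN_B136_one : extNN B136 1 = 0 := by decide +kernel

theorem extPP_B136_one : extPP B136 1 = 0 := by decide +kernel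

theorem extNN_B136_three : extNN B136 3 = 0 := by decide +kernel

theorem extPP_B136_three : extPP B136 3 = 0 := by decide +kernel

/-- **Φ_sep(B136) = 0 + (12 288 − 1 088) + 0 = 11 200**: the (0,2) piece is wiped out by `h²(Hom(𝓟,𝓝)) = 55 296`, the (1,1) piece survives. -/
theorem phiSep_B136 : phiSep B136 = 11200 := by
  unfold phiSep pos
  rw [B136_copies.1, extPN_B136_one, extPN_B136_two, extNP_B136_two, extNP_B136_three, extNN_B136_one, extNN_B136_two,
    extNN_B136_three, extPP_B136_one, extPP_B136_two, extPP_B136_three]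
  norm_num

/-- B136 is killed HONESTLY in the separated currency: `11 200 + 28·(8 − 4) + π > 3 136`. -/
theorem not_budgetClause_phiSep_B136 (π : ℤ) (hπ : 0 ≤ π) : ¬ BudgetClause phiSep π B136 := by
  unfold BudgetClause
  rw [phiSep_B136, B136_copies.2.1]
  omega

theorem not_frameBudget_phiSep_B136 : ¬ FrameBudget phiSep B136 := by
  unfold FrameBudget
  rw [phiSep_B136, B136_copies.2.1]
  norm_num

/-! ### the decoration-free certificate on B136: `Φ_all(B136) = 0` — no kill is certified across exotic decorations -/

theorem extPNcap_B136_two : extPNcap B136 2 = 55296 := by decide +kernel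

theorem extNPcap_B136_two : extNPcap B136 2 = 0 := by decide +kernel

theorem extNNcap_B136_one : extNNcap B136 1 = 8704 := by decide +kernel

theorem extPPcap_B136_one : extPPcap B136 1 = 41472 := by decide +kernel

theorem extNNcap_B136_three : extNNcap B136 3 = 60928 := by decide +kernel

theorem extPPcap_B136_three : extPPcap B136 3 = 290304 := by decide +kernel

/-- `Φ_all(B136) = (3 808 − 55 296)⁺ + (12 288 − 8 704 − 41 472)⁺ + (0 − 351 232 − 55 296)⁺ = 0`: the P–P null ∕ zero blocks (`41 472` in `H¹`)
could, for an adversarial decoration, swallow the (1,1) piece — the crude certificate cannot exclude it (c4-1's block-support rows can). -/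
theorem phiAll_B136 : phiAll B136 = 0 := by
  unfold phiAll pos
  rw [B136_copies.1, extPN_B136_one, extNP_B136_three, extNN_B136_two, extPP_B136_two, extPNcap_B136_two, extNPcap_B136_two,
    extNNcap_B136_one, extPPcap_B136_one, extNNcap_B136_three, extPPcap_B136_three]
  norm_num

/-- so the decoration-free honest clause does NOT exclude B136 (`0 + 112 ≤ 3 136`) — contrast `not_budgetClause_phiSep_B136`. -/
theorem budgetClause_phiAll_B136 : BudgetClause phiAll 0 B136 := by
  unfold BudgetClause
  rw [phiAll_B136, B136_copies.2.1]
  norm_num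

theorem frameBudget_phiAll_B136 : FrameBudget phiAll B136 := by
  unfold FrameBudget
  rw [phiAll_B136, B136_copies.2.1]
  norm_num

/-- sanity of the cap calculus on single letters: the LINE-14 null step `(14;0,0) − (13;0,1) = (1;0,−1)` has caps `[1,1,0]`, its double `[2,2,0]`,
the reversed step `[0,1,1]`, the zero class `[1,2,1]`, and an ample step its exact `[n,0,0]`. -/
theorem capList_examples :
    capList ⟨13, 0, 1⟩ ⟨14, 0, 0⟩ = [1, 1, 0] ∧ capList ⟨12, 0, 2⟩ ⟨14, 0, 0⟩ = [2, 2, 0] ∧ capList ⟨14, 0, 0⟩ ⟨13, 0, 1⟩ = [0, 1, 1] ∧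
    capList ⟨9, 0, 0⟩ ⟨9, 0, 0⟩ = [1, 2, 1] ∧ capList ⟨2, -4, 3⟩ ⟨9, 0, 0⟩ = [24, 0, 0] := by
  decide +kernel

/-- `h^•_cap(𝒪_X) = (1, 8, 28, 56, 70, 56, 28, 8, 1)` (the self-pair of a cell): the diagonal weights `8 ∕ 28 ∕ 56` per copy used in `phiSep`. -/
theorem cellCapPoly_self : cellCapPoly hub4 hub4 = [1, 8, 28, 56, 70, 56, 28, 8, 1] := by decide +kernel

end Summit.HodgeConjecture.HodgeConjecture.Cruxes.BlochSeedDiscOne.RowAlpha3
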